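import Literature.NumberTheory.Automorphic.GLnCuspidalSpectrumProofs        -- ★ `localCongruenceSubgroup`, `…_antitone`, `exists_localCongruenceSubgroup_subset`, `isOpen_`∕`isCompact_…`
import Literature.NumberTheory.Automorphic.GJUnfoldingData                  -- ★ `mem_valuedCongruenceSubgroup_of_valued_le` (one-sided congruence ⇒ membership)
import Literature.NumberTheory.Automorphic.ValuedFieldValuativeRelBridge    -- ★ `v_le_one_iff_valuation_le_one`
import Literature.NumberTheory.Automorphic.SelfDualLatticeCountFrameTransportCM -- ★ `toPlace_uniformizer_ne_zero`, `valued_toPlace_uniformizer`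
import Literature.NumberTheory.Automorphic.UnitaryGroupOfFormAdelicTopology -- ★ `isClosed_unitaryGroupOfForm`
import Literature.NumberTheory.Automorphic.LocalUnitaryGroupCongr           -- ★ `unitaryGroupOfForm`, `placeForm`, `galAdicCompletionMap`
import Literature.NumberTheory.Automorphic.AdelicUnitaryGroupDatum          -- ★ `cmDatum`
import Literature.Topology.LocallyConstantCompactSupportUniform             -- ★ p843341 (D1): `exists_forall_forall_mul_eq_of_hasCompactSupport_of_antitone`
import HarnessLib

/-!
# The LEVEL FAMILY at one place and the common right-level of finitely many test functions on `H_v` (road «R1LL-tree», sub-assembly S2 «COMMON LEVEL»)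

Topic `NumberTheory/Rogawski1990`; namespace `Literature.NumberTheory.Automorphic.UnitaryGroup` (§1) and `Literature.NumberTheory.Rogawski1990` (§2).  THEOREMS ONLY
(no definition, no instance, no notation, no named fact, no `sorry`); kernel lane.  Cell `pub/hodgecm-mathlib`, crux H413 = `stmt-HodgeConjecture-24833`, road
«R1LL-tree» (architect A-p16 (g27)); this is brick S2 of p08 (g14)'s census 8fb5bd5f for the head ED. 2 of ★ `rankOneUnstable_core_inert_of_depthExpansion`:
the `Km` DATA and the `hφm` hypothesis of ★ A-p13 (g31) `finsum_fixedBy_conj_eq_depthExpansion_at` (p843465), supplied from ★ (D1) `LocallyConstantCompactSupportUniform`.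
HONEST LABEL: HC_CM is proved only modulo the 2 remaining named inputs (hLiu418, h413) until rung 0 closes; this file is bookkeeping and asserts nothing printed.

THE MATHEMATICS.  `U_m = {g ∈ GL₂(𝒪_w) | g ≡ 1 (ϖ_w^m)}` (★ `localCongruenceSubgroup 2 L w m`) is a decreasing neighbourhood basis of `1` in `GL₂(L_w)`; for `m ≥ 1` the ONE-SIDED
congruence `ϖ_w^{−m}(g − 1) ∈ M₂(𝒪_w)` already forces `g ∈ U_m` (★ `mem_valuedCongruenceSubgroup_of_valued_le`: `g⁻¹` is then integral).  Pulling back along a one-place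
model `E₂ : U(Φ₂)(L⁺_v) ≃ₜ* U ≤ GL₂(L_w)`, the sets `K_m := {h ∈ H_v | E₂ h.1 ∈ U_m, h.2 = 1}` decrease and shrink into every neighbourhood of `1 ∈ H_v = U(Φ₂)_v × U(Φ₁)_v`, so by
★ (D1) finitely many locally constant compactly supported `φ_k : H_v → Y` have a COMMON right-level `m ≥ 1`: `φ_k(x · (E₂⁻¹ y, 1)) = φ_k(x)` whenever `y ∈ U ∩ U_m` — in
particular `y ↦ φ_k(E₂⁻¹ y, a)` is right-invariant under `Km := (U_m).subgroupOf U`, and `Km` satisfies A-p13's membership law.  (Rogawski 1990 §4.9 p. 54 «`f` is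
bi-invariant under an open subgroup»; Bernstein–Zelevinsky 1976 §1.1.)

* §1 `valued_le_exp_neg_of_zpow_neg_mul_mem`, `mem_localCongruenceSubgroup_of_forall_zpow_neg_mul_sub_one_mem` (A-p13's law ⇒ `∈ U_m`, `m ≥ 1`),
  `isCompact_isOpen_localCongruenceSubgroup_subgroupOf_unitary`.
* §2 `forall_nhds_one_exists_level_subset` (the pulled-back family is a neighbourhood basis), `exists_level_forall_mul_onePlace_eq` (common right-level through `E₂`),
  **`exists_level_data_onePlace`** (the package consumed by S1∕S1′: `m ≥ 1`, `hKm` for `Km := (U_m).subgroupOf U` in ★ p843465's literal shape, and `hφm` for every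
  `y ↦ φ_k (E₂⁻¹ (x′ y), a)`).
* §3 (ED. 2, ANY uniformiser `π`, no `hunr` — serves a RAMIFIED `w` with `π := η` anti-fixed): `valued_le_exp_neg_of_zpow_neg_mul_mem_of_v_eq`,
  `mem_localCongruenceSubgroup_of_forall_zpow_neg_mul_sub_one_mem_of_v_eq`, **`exists_level_data_onePlace_of_v_eq`** (the §2 package with the law written in `π`).

## References
* [Rogawski1990] J. D. Rogawski, *Automorphic Representations of Unitary Groups in Three Variables* (1990), §4.9 p. 54; §1.6 p. 6.
* [BernsteinZelevinsky1976] I. N. Bernstein, A. V. Zelevinsky, *Representations of the group GL(n,F) where F is a non-archimedean local field*, §1.1.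
* [BushnellHenniart2006] C. J. Bushnell, G. Henniart, *The Local Langlands Conjecture for GL(2)* (2006), §1.1 (congruence subgroups `U_m`).
-/

set_option autoImplicit false

noncomputable section

open Topology Set Function Filter NumberField IsDedekindDomain Matrix
open scoped MatrixGroups ValuativeRel

/-! ## §1 One place: A-p13's congruence law and the principal congruence subgroups `U_m` -/

namespace Literature.NumberTheory.Automorphic.UnitaryGroup

open Literature.NumberTheory.GaloisRepresentations

variable (L : Type) [Field L] [NumberField L] [IsCMField L] (v : HeightOneSpectrum (𝓞 ↥(maximalRealSubfield L)))
  (w : PlacesOver L v)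

omit [IsCMField L] in
/-- `ϖ_w^{−m} x ∈ 𝒪_w ⇒ |x|_w ≤ |ϖ_w|^m = exp(−m)` (`v` unramified in `L`, so `ϖ_w := ι_w(ϖ_v)` is a uniformiser ★ `valued_toPlace_uniformizer`). [cite: BushnellHenniart2006, §1.1] -/
theorem valued_le_exp_neg_of_zpow_neg_mul_mem (hunr : Algebra.IsUnramifiedIn (𝓞 L) v.asIdeal) {x : w.1.adicCompletion L} {m : ℕ}
    (h : toPlace v w (HeckeCharacter.uniformizer ↥(maximalRealSubfield L) v : v.adicCompletion ↥(maximalRealSubfield L)) ^ (-(m : ℤ)) * x ∈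
      𝒪[w.1.adicCompletion L]) :
    Valued.v x ≤ WithZero.exp (-(m : ℤ)) := by
  have hϖ0 := toPlace_uniformizer_ne_zero L v w hunr
  have hϖv := valued_toPlace_uniformizer L v w hunr
  set ϖ := toPlace v w (HeckeCharacter.uniformizer ↥(maximalRealSubfield L) v : v.adicCompletion ↥(maximalRealSubfield L)) with hϖdef
  have hy : Valued.v (ϖ ^ (-(m : ℤ)) * x) ≤ 1 :=
    (v_le_one_iff_valuation_le_one _).2 ((Valuation.mem_integer_iff _ _).1 h)
  have hx : x = ϖ ^ m * (ϖ ^ (-(m : ℤ)) * x) := by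
    rw [_root_.zpow_neg, zpow_natCast, mul_inv_cancel_left₀ (pow_ne_zero m hϖ0)]
  rw [hx, map_mul, map_pow, hϖv, ← WithZero.exp_nsmul, nsmul_eq_mul, mul_neg_one]
  exact mul_le_of_le_one_right zero_le hy

omit [IsCMField L] in
/-- **A-p13's ONE-SIDED congruence law forces membership in `U_m`** (`m ≥ 1`): `ϖ_w^{−m}(g − 1) ∈ M₂(𝒪_w) ⇒ g ∈ localCongruenceSubgroup 2 L w m` — the entries of `g` are
then integral and so are those of `g⁻¹` (★ `mem_valuedCongruenceSubgroup_of_valued_le`). [cite: BushnellHenniart2006, §1.1] [cite: BernsteinZelevinsky1976, §1.1] -/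
theorem mem_localCongruenceSubgroup_of_forall_zpow_neg_mul_sub_one_mem (hunr : Algebra.IsUnramifiedIn (𝓞 L) v.asIdeal) {m : ℕ} (hm : 1 ≤ m)
    {g : GL (Fin 2) (w.1.adicCompletion L)}
    (h : ∀ r s, toPlace v w (HeckeCharacter.uniformizer ↥(maximalRealSubfield L) v : v.adicCompletion ↥(maximalRealSubfield L)) ^ (-(m : ℤ)) *
      (((g : Matrix (Fin 2) (Fin 2) (w.1.adicCompletion L)) - 1) r s) ∈ 𝒪[w.1.adicCompletion L]) :
    g ∈ localCongruenceSubgroup 2 L w.1 m := by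
  have h2 : ∀ r s, Valued.v ((((g : Matrix (Fin 2) (Fin 2) (w.1.adicCompletion L)) - 1) r s)) ≤ WithZero.exp (-(m : ℤ)) := fun r s =>
    valued_le_exp_neg_of_zpow_neg_mul_mem L v w hunr (h r s)
  have hc : (WithZero.exp (-(m : ℤ)) : WithZero (Multiplicative ℤ)) < 1 := by
    rw [← WithZero.exp_zero, WithZero.exp_lt_exp]; omega
  have h1 : ∀ r s, Valued.v ((g : Matrix (Fin 2) (Fin 2) (w.1.adicCompletion L)) r s) ≤ 1 := by
    intro r s
    have hsplit : (g : Matrix (Fin 2) (Fin 2) (w.1.adicCompletion L)) r s =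
        (((g : Matrix (Fin 2) (Fin 2) (w.1.adicCompletion L)) - 1) r s) + (1 : Matrix (Fin 2) (Fin 2) (w.1.adicCompletion L)) r s := by
      rw [Matrix.sub_apply, sub_add_cancel]
    rw [hsplit]
    refine (Valuation.map_add _ _ _).trans (max_le ((h2 r s).trans hc.le) ?_)
    rw [Matrix.one_apply]
    split_ifs
    · rw [map_one]
    · rw [map_zero]; exact zero_le_one
  exact mem_valuedCongruenceSubgroup_of_valued_le hc h1 h2

variable (hw : IsCMField.complexConj L • w.1 = w.1)

/-- `U ∩ U_m` is compact and open in `U = U(σ_w, J)(L_w)` (★ `isCompact_`∕`isOpen_localCongruenceSubgroup`, `U` closed ★ `isClosed_unitaryGroupOfForm`).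
[cite: BernsteinZelevinsky1976, §1.1] -/
theorem isCompact_isOpen_localCongruenceSubgroup_subgroupOf_unitary (J : Matrix (Fin 2) (Fin 2) (w.1.adicCompletion L)) (m : ℕ) :
    IsCompact (((localCongruenceSubgroup 2 L w.1 m).subgroupOf (unitaryGroupOfForm (galAdicCompletionMap (L := L) (IsCMField.complexConj L) hw) J) :
        Subgroup ↥(unitaryGroupOfForm (galAdicCompletionMap (L := L) (IsCMField.complexConj L) hw) J)) :
        Set ↥(unitaryGroupOfForm (galAdicCompletionMap (L := L) (IsCMField.complexConj L) hw) J)) ∧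
      IsOpen (((localCongruenceSubgroup 2 L w.1 m).subgroupOf (unitaryGroupOfForm (galAdicCompletionMap (L := L) (IsCMField.complexConj L) hw) J) :
        Subgroup ↥(unitaryGroupOfForm (galAdicCompletionMap (L := L) (IsCMField.complexConj L) hw) J)) :
        Set ↥(unitaryGroupOfForm (galAdicCompletionMap (L := L) (IsCMField.complexConj L) hw) J)) := by
  have hU : IsClosed ((unitaryGroupOfForm (galAdicCompletionMap (L := L) (IsCMField.complexConj L) hw) J : Subgroup (GL (Fin 2) (w.1.adicCompletion L))) :
      Set (GL (Fin 2) (w.1.adicCompletion L))) :=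
    isClosed_unitaryGroupOfForm (continuous_galAdicCompletionMap (L := L) (IsCMField.complexConj L) hw) J
  refine ⟨?_, ?_⟩
  · rw [Subgroup.coe_subgroupOf]; exact hU.isClosedEmbedding_subtypeVal.isCompact_preimage (isCompact_localCongruenceSubgroup 2 L w.1 m)
  · rw [Subgroup.coe_subgroupOf]; exact (isOpen_localCongruenceSubgroup 2 L w.1 m).preimage continuous_subtype_val

end Literature.NumberTheory.Automorphic.UnitaryGroup

/-! ## §2 `H_v`: the pulled-back family is a neighbourhood basis; common right-level of finitely many test functions -/

namespace Literature.NumberTheory.Rogawski1990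

open Literature.NumberTheory.Automorphic Literature.NumberTheory.Automorphic.UnitaryGroup Literature.NumberTheory.GaloisRepresentations

variable (L : Type) [Field L] [NumberField L] [IsCMField L] (v : HeightOneSpectrum (𝓞 ↥(maximalRealSubfield L)))
  (w : PlacesOver L v) (hw : IsCMField.complexConj L • w.1 = w.1)

/-- **The pulled-back level family is a neighbourhood basis of `1 ∈ H_v`**: for every `V ∈ 𝓝 1` there is `m` with `{h | E₂ h.1 ∈ U_m, h.2 = 1} ⊆ V`
(★ `exists_localCongruenceSubgroup_subset` in `GL₂(L_w)`, the subtype topology of `U`, continuity of `y ↦ (E₂⁻¹ y, 1)`). [cite: BernsteinZelevinsky1976, §1.1] -/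
theorem forall_nhds_one_exists_level_subset
    (E₂ : (cmDatum L 2 (Matrix.of fun i j : Fin 2 => if i.val + j.val + 1 = 2 then (1 : L) else 0)).Local v ≃ₜ*
      ↥(unitaryGroupOfForm (galAdicCompletionMap (L := L) (IsCMField.complexConj L) hw)
        (placeForm (Matrix.of fun i j : Fin 2 => if i.val + j.val + 1 = 2 then (1 : L) else 0) w.1)))
    (V : Set (((cmDatum L 2 (Matrix.of fun i j : Fin 2 => if i.val + j.val + 1 = 2 then (1 : L) else 0)).Local v ×
      (cmDatum L 1 (Matrix.of fun i j : Fin 1 => if i.val + j.val + 1 = 1 then (1 : L) else 0)).Local v)))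
    (hV : V ∈ 𝓝 (1 : ((cmDatum L 2 (Matrix.of fun i j : Fin 2 => if i.val + j.val + 1 = 2 then (1 : L) else 0)).Local v ×
      (cmDatum L 1 (Matrix.of fun i j : Fin 1 => if i.val + j.val + 1 = 1 then (1 : L) else 0)).Local v))) :
    ∃ m : ℕ, ∀ h : ((cmDatum L 2 (Matrix.of fun i j : Fin 2 => if i.val + j.val + 1 = 2 then (1 : L) else 0)).Local v ×
        (cmDatum L 1 (Matrix.of fun i j : Fin 1 => if i.val + j.val + 1 = 1 then (1 : L) else 0)).Local v),
      ((E₂ h.1 : ↥(unitaryGroupOfForm (galAdicCompletionMap (L := L) (IsCMField.complexConj L) hw)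
          (placeForm (Matrix.of fun i j : Fin 2 => if i.val + j.val + 1 = 2 then (1 : L) else 0) w.1))) : GL (Fin 2) (w.1.adicCompletion L)) ∈
        localCongruenceSubgroup 2 L w.1 m → h.2 = 1 → h ∈ V := by
  -- the continuous section `y ↦ (E₂⁻¹ y, 1)` of the first factor
  set ι : ↥(unitaryGroupOfForm (galAdicCompletionMap (L := L) (IsCMField.complexConj L) hw)
      (placeForm (Matrix.of fun i j : Fin 2 => if i.val + j.val + 1 = 2 then (1 : L) else 0) w.1)) →
      ((cmDatum L 2 (Matrix.of fun i j : Fin 2 => if i.val + j.val + 1 = 2 then (1 : L) else 0)).Local v ×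
        (cmDatum L 1 (Matrix.of fun i j : Fin 1 => if i.val + j.val + 1 = 1 then (1 : L) else 0)).Local v) := fun y => (E₂.symm y, 1) with hι
  have hιc : Continuous ι := E₂.symm.continuous.prodMk continuous_const
  have hι1 : ι 1 = 1 := by rw [hι]; simp only [map_one]; rfl
  have hV' : ι ⁻¹' V ∈ 𝓝 (1 : ↥(unitaryGroupOfForm (galAdicCompletionMap (L := L) (IsCMField.complexConj L) hw)
      (placeForm (Matrix.of fun i j : Fin 2 => if i.val + j.val + 1 = 2 then (1 : L) else 0) w.1))) :=
    hιc.continuousAt.preimage_mem_nhds (by rw [hι1]; exact hV)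
  obtain ⟨W, hW, hWV⟩ := (mem_nhds_subtype _ _ _).1 hV'
  obtain ⟨m, hm⟩ := exists_localCongruenceSubgroup_subset 2 L w.1 hW
  refine ⟨m, fun h hh h2 => ?_⟩
  have hmem : E₂ h.1 ∈ ι ⁻¹' V := hWV (hm hh)
  rw [Set.mem_preimage, hι] at hmem
  simp only [ContinuousMulEquiv.symm_apply_apply] at hmem
  obtain ⟨h₁, h₂⟩ := h
  simp only at h2 hmem
  subst h2
  exact hmem

/-- **COMMON RIGHT-LEVEL THROUGH THE ONE-PLACE MODEL**: finitely many locally constant compactly supported `φ_k : H_v → Y` admit `m ≥ 1` with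
`φ_k(x · (E₂⁻¹ y, 1)) = φ_k(x)` for all `x ∈ H_v` and all `y ∈ U ∩ U_m` (★ (D1) `exists_forall_forall_mul_eq_of_hasCompactSupport_of_antitone` on the pulled-back family).
[cite: Rogawski1990, §4.9 p. 54] [cite: BernsteinZelevinsky1976, §1.1] -/
theorem exists_level_forall_mul_onePlace_eq
    (E₂ : (cmDatum L 2 (Matrix.of fun i j : Fin 2 => if i.val + j.val + 1 = 2 then (1 : L) else 0)).Local v ≃ₜ*
      ↥(unitaryGroupOfForm (galAdicCompletionMap (L := L) (IsCMField.complexConj L) hw)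
        (placeForm (Matrix.of fun i j : Fin 2 => if i.val + j.val + 1 = 2 then (1 : L) else 0) w.1)))
    {κ : Type*} [Finite κ] {Y : Type*} [Zero Y]
    (φ : κ → (((cmDatum L 2 (Matrix.of fun i j : Fin 2 => if i.val + j.val + 1 = 2 then (1 : L) else 0)).Local v ×
      (cmDatum L 1 (Matrix.of fun i j : Fin 1 => if i.val + j.val + 1 = 1 then (1 : L) else 0)).Local v)) → Y)
    (hφ : ∀ k, IsLocallyConstant (φ k)) (hφs : ∀ k, HasCompactSupport (φ k)) :
    ∃ m : ℕ, 1 ≤ m ∧ ∀ (k : κ) (x : ((cmDatum L 2 (Matrix.of fun i j : Fin 2 => if i.val + j.val + 1 = 2 then (1 : L) else 0)).Local v ×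
        (cmDatum L 1 (Matrix.of fun i j : Fin 1 => if i.val + j.val + 1 = 1 then (1 : L) else 0)).Local v))
      (y : ↥(unitaryGroupOfForm (galAdicCompletionMap (L := L) (IsCMField.complexConj L) hw)
        (placeForm (Matrix.of fun i j : Fin 2 => if i.val + j.val + 1 = 2 then (1 : L) else 0) w.1))),
      ((y : ↥(unitaryGroupOfForm (galAdicCompletionMap (L := L) (IsCMField.complexConj L) hw)
          (placeForm (Matrix.of fun i j : Fin 2 => if i.val + j.val + 1 = 2 then (1 : L) else 0) w.1))) : GL (Fin 2) (w.1.adicCompletion L)) ∈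
        localCongruenceSubgroup 2 L w.1 m →
      φ k (x * (E₂.symm y, 1)) = φ k x := by
  classical
  -- the pulled-back family
  let K : ℕ → Set (((cmDatum L 2 (Matrix.of fun i j : Fin 2 => if i.val + j.val + 1 = 2 then (1 : L) else 0)).Local v ×
      (cmDatum L 1 (Matrix.of fun i j : Fin 1 => if i.val + j.val + 1 = 1 then (1 : L) else 0)).Local v)) := fun m =>
    {h | ((E₂ h.1 : ↥(unitaryGroupOfForm (galAdicCompletionMap (L := L) (IsCMField.complexConj L) hw)
          (placeForm (Matrix.of fun i j : Fin 2 => if i.val + j.val + 1 = 2 then (1 : L) else 0) w.1))) : GL (Fin 2) (w.1.adicCompletion L)) ∈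
        localCongruenceSubgroup 2 L w.1 m ∧ h.2 = 1}
  have hK : ∀ V ∈ 𝓝 (1 : ((cmDatum L 2 (Matrix.of fun i j : Fin 2 => if i.val + j.val + 1 = 2 then (1 : L) else 0)).Local v ×
      (cmDatum L 1 (Matrix.of fun i j : Fin 1 => if i.val + j.val + 1 = 1 then (1 : L) else 0)).Local v)), ∃ m, K m ⊆ V := by
    intro V hV
    obtain ⟨m, hm⟩ := forall_nhds_one_exists_level_subset L v w hw E₂ V hV
    exact ⟨m, fun h hh => hm h hh.1 hh.2⟩
  have hKa : Antitone K := fun m m' hmm' h hh => ⟨localCongruenceSubgroup_antitone 2 L w.1 hmm' hh.1, hh.2⟩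
  obtain ⟨m, hm⟩ := Literature.Topology.exists_forall_forall_mul_eq_of_hasCompactSupport_of_antitone hK hKa hφ hφs
  refine ⟨max m 1, le_max_right _ _, fun k x y hy => hm (max m 1) (le_max_left _ _) k x (E₂.symm y, 1) ⟨?_, rfl⟩⟩
  simp only [ContinuousMulEquiv.apply_symm_apply]
  exact hy

/-- **THE S2 PACKAGE (consumed by S1∕S1′ of the head ED. 2)**: a common level `m ≥ 1` such that, with `Km := (localCongruenceSubgroup 2 L w m).subgroupOf U`
(compact open in `U`, §1), (i) A-p13's membership law holds for `Km` in ★ p843465's literal shape, and (ii) for every piece `k`, every `a ∈ U(Φ₁)_v` and every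
`x′ ∈ U`, the one-place test function `y ↦ φ_k (E₂⁻¹ y, a)` is right-`Km`-invariant: `φ_k (E₂⁻¹ (x′ y), a) = φ_k (E₂⁻¹ x′, a)` for `y ∈ Km`.
[cite: Rogawski1990, §4.9 p. 54] [cite: BernsteinZelevinsky1976, §1.1] [cite: BushnellHenniart2006, §1.1] -/
theorem exists_level_data_onePlace (hunr : Algebra.IsUnramifiedIn (𝓞 L) v.asIdeal)
    (E₂ : (cmDatum L 2 (Matrix.of fun i j : Fin 2 => if i.val + j.val + 1 = 2 then (1 : L) else 0)).Local v ≃ₜ*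
      ↥(unitaryGroupOfForm (galAdicCompletionMap (L := L) (IsCMField.complexConj L) hw)
        (placeForm (Matrix.of fun i j : Fin 2 => if i.val + j.val + 1 = 2 then (1 : L) else 0) w.1)))
    {κ : Type*} [Finite κ] {Y : Type*} [Zero Y]
    (φ : κ → (((cmDatum L 2 (Matrix.of fun i j : Fin 2 => if i.val + j.val + 1 = 2 then (1 : L) else 0)).Local v ×
      (cmDatum L 1 (Matrix.of fun i j : Fin 1 => if i.val + j.val + 1 = 1 then (1 : L) else 0)).Local v)) → Y)
    (hφ : ∀ k, IsLocallyConstant (φ k)) (hφs : ∀ k, HasCompactSupport (φ k)) :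
    ∃ m : ℕ, 1 ≤ m ∧
      (∀ y : ↥(unitaryGroupOfForm (galAdicCompletionMap (L := L) (IsCMField.complexConj L) hw)
          (placeForm (Matrix.of fun i j : Fin 2 => if i.val + j.val + 1 = 2 then (1 : L) else 0) w.1)),
        (∀ r s, toPlace v w (HeckeCharacter.uniformizer ↥(maximalRealSubfield L) v : v.adicCompletion ↥(maximalRealSubfield L)) ^ (-(m : ℤ)) *
          ((((y : ↥(unitaryGroupOfForm (galAdicCompletionMap (L := L) (IsCMField.complexConj L) hw)
              (placeForm (Matrix.of fun i j : Fin 2 => if i.val + j.val + 1 = 2 then (1 : L) else 0) w.1))) :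
              GL (Fin 2) (w.1.adicCompletion L)) : Matrix (Fin 2) (Fin 2) (w.1.adicCompletion L)) - 1) r s ∈ 𝒪[w.1.adicCompletion L]) →
        y ∈ (localCongruenceSubgroup 2 L w.1 m).subgroupOf
          (unitaryGroupOfForm (galAdicCompletionMap (L := L) (IsCMField.complexConj L) hw)
            (placeForm (Matrix.of fun i j : Fin 2 => if i.val + j.val + 1 = 2 then (1 : L) else 0) w.1))) ∧
      ∀ (k : κ) (a : (cmDatum L 1 (Matrix.of fun i j : Fin 1 => if i.val + j.val + 1 = 1 then (1 : L) else 0)).Local v)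
        (x' : ↥(unitaryGroupOfForm (galAdicCompletionMap (L := L) (IsCMField.complexConj L) hw)
          (placeForm (Matrix.of fun i j : Fin 2 => if i.val + j.val + 1 = 2 then (1 : L) else 0) w.1))),
        ∀ y ∈ (localCongruenceSubgroup 2 L w.1 m).subgroupOf
          (unitaryGroupOfForm (galAdicCompletionMap (L := L) (IsCMField.complexConj L) hw)
            (placeForm (Matrix.of fun i j : Fin 2 => if i.val + j.val + 1 = 2 then (1 : L) else 0) w.1)),
          φ k (E₂.symm (x' * y), a) = φ k (E₂.symm x', a) := by
  obtain ⟨m, hm1, hm⟩ := exists_level_forall_mul_onePlace_eq L v w hw E₂ φ hφ hφs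
  refine ⟨m, hm1, fun y hy => Subgroup.mem_subgroupOf.2
    (mem_localCongruenceSubgroup_of_forall_zpow_neg_mul_sub_one_mem L v w hunr hm1 hy), fun k a x' y hy => ?_⟩
  have h := hm k (E₂.symm x', a) y (Subgroup.mem_subgroupOf.1 hy)
  rw [Prod.mk_mul_mk, mul_one, ← map_mul] at h
  exact h

end Literature.NumberTheory.Rogawski1990


/-! ## §3 (ED. 2) The same with ANY uniformiser `π` of `L_w` (`|π|_w = exp(−1)`; no unramifiedness — the ramified place takes `π := η` anti-fixed) -/

namespace Literature.NumberTheory.Automorphic.UnitaryGroup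

open Literature.NumberTheory.GaloisRepresentations

variable (L : Type) [Field L] [NumberField L] (v : HeightOneSpectrum (𝓞 ↥(maximalRealSubfield L))) (w : PlacesOver L v)

/-- `π^{−m} x ∈ 𝒪_w ⇒ |x|_w ≤ exp(−m)` for any `π` with `|π|_w = exp(−1)`. [cite: BushnellHenniart2006, §1.1] -/
theorem valued_le_exp_neg_of_zpow_neg_mul_mem_of_v_eq {π : w.1.adicCompletion L} (hπ : Valued.v π = WithZero.exp (-1 : ℤ))
    {x : w.1.adicCompletion L} {m : ℕ} (h : π ^ (-(m : ℤ)) * x ∈ 𝒪[w.1.adicCompletion L]) :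
    Valued.v x ≤ WithZero.exp (-(m : ℤ)) := by
  have hπ0 : π ≠ 0 := fun h0 => by rw [h0, map_zero] at hπ; exact WithZero.zero_ne_coe hπ
  have hy : Valued.v (π ^ (-(m : ℤ)) * x) ≤ 1 :=
    (v_le_one_iff_valuation_le_one _).2 ((Valuation.mem_integer_iff _ _).1 h)
  have hx : x = π ^ m * (π ^ (-(m : ℤ)) * x) := by
    rw [_root_.zpow_neg, zpow_natCast, mul_inv_cancel_left₀ (pow_ne_zero m hπ0)]
  rw [hx, map_mul, map_pow, hπ, ← WithZero.exp_nsmul, nsmul_eq_mul, mul_neg_one]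
  exact mul_le_of_le_one_right zero_le hy

/-- **The one-sided law in `π` forces membership in `U_m`** (`m ≥ 1`): `π^{−m}(g − 1) ∈ M₂(𝒪_w) ⇒ g ∈ localCongruenceSubgroup 2 L w m`. [cite: BushnellHenniart2006, §1.1] -/
theorem mem_localCongruenceSubgroup_of_forall_zpow_neg_mul_sub_one_mem_of_v_eq {π : w.1.adicCompletion L}
    (hπ : Valued.v π = WithZero.exp (-1 : ℤ)) {m : ℕ} (hm : 1 ≤ m) {g : GL (Fin 2) (w.1.adicCompletion L)}
    (h : ∀ r s, π ^ (-(m : ℤ)) * ((((g : GL (Fin 2) (w.1.adicCompletion L)) : Matrix (Fin 2) (Fin 2) (w.1.adicCompletion L)) - 1) r s) ∈ 𝒪[w.1.adicCompletion L]) :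
    g ∈ localCongruenceSubgroup 2 L w.1 m := by
  have h2 : ∀ r s, Valued.v ((((g : Matrix (Fin 2) (Fin 2) (w.1.adicCompletion L)) - 1) r s)) ≤ WithZero.exp (-(m : ℤ)) := fun r s =>
    valued_le_exp_neg_of_zpow_neg_mul_mem_of_v_eq L v w hπ (h r s)
  have hc : (WithZero.exp (-(m : ℤ)) : WithZero (Multiplicative ℤ)) < 1 := by
    rw [← WithZero.exp_zero, WithZero.exp_lt_exp]; omega
  have h1 : ∀ r s, Valued.v ((g : Matrix (Fin 2) (Fin 2) (w.1.adicCompletion L)) r s) ≤ 1 := by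
    intro r s
    have hsplit : (g : Matrix (Fin 2) (Fin 2) (w.1.adicCompletion L)) r s =
        (((g : Matrix (Fin 2) (Fin 2) (w.1.adicCompletion L)) - 1) r s) + (1 : Matrix (Fin 2) (Fin 2) (w.1.adicCompletion L)) r s := by
      rw [Matrix.sub_apply, sub_add_cancel]
    rw [hsplit]
    refine (Valuation.map_add _ _ _).trans (max_le ((h2 r s).trans hc.le) ?_)
    rw [Matrix.one_apply]
    split_ifs
    · rw [map_one]
    · rw [map_zero]; exact zero_le_one
  exact mem_valuedCongruenceSubgroup_of_valued_le hc h1 h2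

end Literature.NumberTheory.Automorphic.UnitaryGroup

namespace Literature.NumberTheory.Rogawski1990

open Literature.NumberTheory.Automorphic Literature.NumberTheory.Automorphic.UnitaryGroup Literature.NumberTheory.GaloisRepresentations

variable (L : Type) [Field L] [NumberField L] [IsCMField L] (v : HeightOneSpectrum (𝓞 ↥(maximalRealSubfield L)))
  (w : PlacesOver L v) (hw : IsCMField.complexConj L • w.1 = w.1)

/-- **THE S2 PACKAGE WITH THE LAW IN ANY UNIFORMISER `π`** (`|π|_w = exp(−1)`; at a ramified `w` take `π := η` anti-fixed ★ `exists_uniformizer_galAdicCompletionMap_complexConj_eq_neg_of_ramified`):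
a common level `m ≥ 1` with `Km := (localCongruenceSubgroup 2 L w m).subgroupOf U`, the one-sided law `π^{−m}(y − 1) ∈ M₂(𝒪_w) ⇒ y ∈ Km`, and right-`Km`-invariance of every
`y ↦ φ_k (E₂⁻¹ (x′ y), a)`. [cite: Rogawski1990, §4.9 p. 54] [cite: BernsteinZelevinsky1976, §1.1] [cite: BushnellHenniart2006, §1.1] -/
theorem exists_level_data_onePlace_of_v_eq {π : w.1.adicCompletion L} (hπ : Valued.v π = WithZero.exp (-1 : ℤ))
    (E₂ : (cmDatum L 2 (Matrix.of fun i j : Fin 2 => if i.val + j.val + 1 = 2 then (1 : L) else 0)).Local v ≃ₜ* ↥(unitaryGroupOfForm (galAdicCompletionMap (L := L) (IsCMField.complexConj L) hw) (placeForm (Matrix.of fun i j : Fin 2 => if i.val + j.val + 1 = 2 then (1 : L) else 0) w.1)))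
    {κ : Type*} [Finite κ] {Y : Type*} [Zero Y]
    (φ : κ → (((cmDatum L 2 (Matrix.of fun i j : Fin 2 => if i.val + j.val + 1 = 2 then (1 : L) else 0)).Local v × (cmDatum L 1 (Matrix.of fun i j : Fin 1 => if i.val + j.val + 1 = 1 then (1 : L) else 0)).Local v)) → Y)
    (hφ : ∀ k, IsLocallyConstant (φ k)) (hφs : ∀ k, HasCompactSupport (φ k)) :
    ∃ m : ℕ, 1 ≤ m ∧
      (∀ y : ↥(unitaryGroupOfForm (galAdicCompletionMap (L := L) (IsCMField.complexConj L) hw) (placeForm (Matrix.of fun i j : Fin 2 => if i.val + j.val + 1 = 2 then (1 : L) else 0) w.1)),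
        (∀ r s, π ^ (-(m : ℤ)) * ((((y : ↥(unitaryGroupOfForm (galAdicCompletionMap (L := L) (IsCMField.complexConj L) hw) (placeForm (Matrix.of fun i j : Fin 2 => if i.val + j.val + 1 = 2 then (1 : L) else 0) w.1))) : GL (Fin 2) (w.1.adicCompletion L)) : Matrix (Fin 2) (Fin 2) (w.1.adicCompletion L)) - 1) r s ∈ 𝒪[w.1.adicCompletion L]) →
        y ∈ (localCongruenceSubgroup 2 L w.1 m).subgroupOf (unitaryGroupOfForm (galAdicCompletionMap (L := L) (IsCMField.complexConj L) hw) (placeForm (Matrix.of fun i j : Fin 2 => if i.val + j.val + 1 = 2 then (1 : L) else 0) w.1))) ∧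
      ∀ (k : κ) (a : (cmDatum L 1 (Matrix.of fun i j : Fin 1 => if i.val + j.val + 1 = 1 then (1 : L) else 0)).Local v) (x' : ↥(unitaryGroupOfForm (galAdicCompletionMap (L := L) (IsCMField.complexConj L) hw) (placeForm (Matrix.of fun i j : Fin 2 => if i.val + j.val + 1 = 2 then (1 : L) else 0) w.1))),
        ∀ y ∈ (localCongruenceSubgroup 2 L w.1 m).subgroupOf (unitaryGroupOfForm (galAdicCompletionMap (L := L) (IsCMField.complexConj L) hw) (placeForm (Matrix.of fun i j : Fin 2 => if i.val + j.val + 1 = 2 then (1 : L) else 0) w.1)),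
          φ k (E₂.symm (x' * y), a) = φ k (E₂.symm x', a) := by
  obtain ⟨m, hm1, hm⟩ := exists_level_forall_mul_onePlace_eq L v w hw E₂ φ hφ hφs
  refine ⟨m, hm1, fun y hy => Subgroup.mem_subgroupOf.2
    (mem_localCongruenceSubgroup_of_forall_zpow_neg_mul_sub_one_mem_of_v_eq L v w hπ hm1 hy), fun k a x' y hy => ?_⟩
  have h := hm k (E₂.symm x', a) y (Subgroup.mem_subgroupOf.1 hy)
  rw [Prod.mk_mul_mk, mul_one, ← map_mul] at h
  exact h

end Literature.NumberTheory.Rogawski1990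

end
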